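import Summits.QuantumFields.BalabanUV.T4Continuum.Support.SkeletonFill

/-!
# T⁴ programme, node NE3 — kinematic refinement lemma, leaf R1c∕R1d (row NE3-S4d), file F2: THE CLOSED-FORM FILLING OF
# ALL CELLS — one formula for every fine bond of `ℤ^d` extending row S4c's 2-skeleton filling `SkeletonFill.skelFill` to the
# interiors of the coarse cells of dimension `m ≥ 3` («complete axial filling from one face with even `L`-th-root rows»),
# with the FOUR exact plaquette words (group level)

Cell `pub-balaban`, NE3 formalisation swarm, unit `b2b-balaban-t4-ne3-formalise-leaf-07` (LEAF PROVER 07), row **S4d** of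
`t4/formal/NE3/LEAVES.md` = leaf R1c∕R1d of the OWNER skeleton `t4/b2b-balaban-t4-ne3-p1/SKELETON-NE3-P1.md` v1.1 §2 ¶3 ∕ §3
of the KINEMATIC lemma `MinimalActionRefine.SmoothRefine`; SHAPE `t4/formal/NE3/Statements/S4d-SHAPE-v1.md`.

THE CLOSED FORM.  Data as in row S4c: the 1-skeleton datum `T` (LAST fine bond of each coarse chain) and the root datum `h`
(per coarse plaquette `(z; κ < ν)`, meant to satisfy `h^{L²} = T(∂p)`).  For the fine bond in direction `μ` at coarse site `z`,
offsets `q ∈ [0, L)^d`: `fullVal L T h z q μ = [Π_{ν>μ}↑ (h(z;μ,ν)^{q_ν})⁻¹] · ([Π_{κ<μ}↑ h(z;κ,μ)^{q_κ L}] · T(z,μ) if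
q_μ = L − 1, else 1)` (ordered products, increasing index): inside an m-cell the bonds of the HIGHEST direction are `1` except
in the top layer (complete axial gauge from the bottom face), a `μ`-bond carries the ROW POWERS `h(z;μ,ν)^{−q_ν}` of every
higher `ν` («even rows») and, on the far face `q_μ = L − 1`, the compensating powers of the lower directions times the chain
datum.  On bonds with ≤ 1 non-zero transverse offset this IS `SkeletonFill.cellVal`, so `fullFill` is LAWFUL and row S4c's
`hol_plaq_eq` (every 2-cell plaquette `= h`) ∕ `hol_seg_eq` (every chain product `= T`) transfer BY NAME.

CONTENT (all [folklore]; any `Group G`; 0 sorry).  §1 ordered products (`prodOver`, single-factor ∕ congruence ∕ subgroup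
lemmas), `hiProd`, `loProd`, `fullVal`, `fullFill` and their shift invariances; §2 `fullVal_eq_cellVal`, **`lawfulFill_fullFill`**,
`hol_plaq_fullFill_twoCell`, `hol_seg_fullFill`; §3 block coordinates of the shifted sites (step ∕ carry) and the bond values at
the four bonds of a plaquette; §4 **THE FOUR PLAQUETTE WORDS** for `μ < ν` with ARBITRARY other offsets (the plaquettes interior
to cells of every dimension): `hol_plaq_fullFill_inner` (`q_μ, q_ν < L−1`), `…_farμ`, `…_farν`, `…_corner` — explicit words in
the row ∕ compensating products of the block and, across a far face, of the neighbouring block CONJUGATED BY THE CHAIN DATUM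
(the neighbour's roots arrive parallel-transported: the covariant root gradient of file F3); §5 `fullFill_mem` (values in any
subgroup ∋ data: unitarity), `fullFill_add_period` (`P`-periodic data ⇒ `L·P`-periodic filling).  NOT here: any estimate
(file F3 `SkeletonFillFullBounds`), the average (42) beyond `hol_seg_eq`, the mismatch (S4e), the exact correction (R2), R0.

HONEST FRAMING.  Group-level lattice gauge kinematics; no minimiser, no variational problem; no conditional of the cell
(`BetaPertH`, (B), (B^μ)); nothing bears on infinite volume, a mass gap, or the Clay problem; **NE3 is NOT proved** — one leaf
(R1c∕R1d) of the kinematic lemma `SmoothRefine` (ours, unproved), which instantiates NO leaf of NE3 on Bałaban's minimisers.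
Finite T⁴ rung (B)+1.  ABSOLUTE RULE kept: no printed sentence is a hypothesis; no `def … : Prop` fact; no `sorry`, axioms ⊆
{propext, Classical.choice, Quot.sound}.  Ancestry as in `SkeletonFill` (Lüscher 1982, 't Hooft 1995, Endres et al. 2015:
cell-by-cell interpolation under plaquette bounds; none has this closed form) — OURS, elementary, manuscript-free.  PLACEMENT
(human rule 2026-08-19): under `Summits/QuantumFields/BalabanUV/`; imports row S4c's `SkeletonFill` only; moves nothing.
-/

set_option autoImplicit false

namespace Summit.QuantumFields.BalabanUV.T4Continuum.SkeletonFillFull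

open Literature.MathematicalPhysics.QuantumFieldTheory.Balaban1983to89
open B7Prop1Explicit B7Prop2Explicit B7Prop1Local
open SkeletonLattice SkeletonFill

variable {d : ℕ}

/-! ## §1 Ordered products over directions; the closed form -/

section Products

variable {G : Type*} [Group G]

/-- The ordered product `Π_{λ ∈ l} f λ` over a list of directions (increasing list position = left to right). [folklore] -/
def prodOver (l : List (Fin d)) (f : Fin d → G) : G := (l.map f).prod

/-- `prodOver [] f = 1`. [folklore] -/
@[simp] theorem prodOver_nil (f : Fin d → G) : prodOver [] f = 1 := by simp [prodOver]
/-- `prodOver (a :: l) f = f a * prodOver l f`. [folklore] -/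
@[simp] theorem prodOver_cons (a : Fin d) (l : List (Fin d)) (f : Fin d → G) :
    prodOver (a :: l) f = f a * prodOver l f := by simp [prodOver]

/-- An ordered product all of whose factors are `1` is `1`. [folklore] -/
theorem prodOver_eq_one {l : List (Fin d)} {f : Fin d → G} (h1 : ∀ i ∈ l, f i = 1) : prodOver l f = 1 := by
  induction l with
  | nil => simp
  | cons a l ih =>
    rw [prodOver_cons, h1 a (by simp), one_mul]
    exact ih fun i hi => h1 i (by simp [hi])

/-- **SINGLE FACTOR**: over a duplicate-free list whose factors are `1` except possibly at `ν`, the ordered product is that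
factor (or `1` if `ν ∉ l`). [folklore] -/
theorem prodOver_eq_single {l : List (Fin d)} (hl : l.Nodup) (f : Fin d → G) (ν : Fin d)
    (h1 : ∀ i ∈ l, i ≠ ν → f i = 1) : prodOver l f = if ν ∈ l then f ν else 1 := by
  induction l with
  | nil => simp
  | cons a l ih =>
    rw [List.nodup_cons] at hl
    rw [prodOver_cons]
    by_cases ha : a = ν
    · subst ha
      rw [prodOver_eq_one (fun i hi => h1 i (by simp [hi]) (fun h => hl.1 (h ▸ hi))), mul_one, if_pos (by simp)]
    · rw [h1 a (by simp) ha, one_mul, ih hl.2 (fun i hi hne => h1 i (by simp [hi]) hne)]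
      simp [Ne.symm ha]

/-- Congruence: factors agreeing on the list give the same ordered product. [folklore] -/
theorem prodOver_congr {l : List (Fin d)} {f g : Fin d → G} (h : ∀ i ∈ l, f i = g i) : prodOver l f = prodOver l g := by
  unfold prodOver
  rw [List.map_congr_left h]

/-- All factors in a subgroup ⇒ the ordered product is in the subgroup. [folklore] -/
theorem prodOver_mem {S : Subgroup G} {l : List (Fin d)} {f : Fin d → G} (h : ∀ i ∈ l, f i ∈ S) : prodOver l f ∈ S := by
  induction l with
  | nil => simp [S.one_mem]
  | cons a l ih =>
    rw [prodOver_cons]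
    exact S.mul_mem (h a (by simp)) (ih fun i hi => h i (by simp [hi]))

/-- The directions above `μ`, increasing. [folklore] -/
def above (μ : Fin d) : List (Fin d) := (List.finRange d).filter fun ν => μ < ν

/-- The directions below `μ`, increasing. [folklore] -/
def below (μ : Fin d) : List (Fin d) := (List.finRange d).filter fun κ => κ < μ

/-- Membership in `above μ`. [folklore] -/
@[simp] theorem mem_above {μ ν : Fin d} : ν ∈ above μ ↔ μ < ν := by simp [above]
/-- Membership in `below μ`. [folklore] -/
@[simp] theorem mem_below {μ κ : Fin d} : κ ∈ below μ ↔ κ < μ := by simp [below]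

/-- `above μ` has no duplicates. [folklore] -/
theorem nodup_above (μ : Fin d) : (above μ).Nodup := (List.nodup_finRange d).filter _

/-- `below μ` has no duplicates. [folklore] -/
theorem nodup_below (μ : Fin d) : (below μ).Nodup := (List.nodup_finRange d).filter _

/-- THE ROW PRODUCT of a `μ`-bond: `Π_{ν > μ}↑ (h(z; μ, ν)^{q_ν})⁻¹` (one «even row» factor per higher direction). [folklore] -/
def hiProd (h : Site d → Fin d → Fin d → G) (z q : Site d) (μ : Fin d) : G :=
  prodOver (above μ) fun ν => ((h z μ ν) ^ (q ν).toNat)⁻¹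

/-- THE COMPENSATING PRODUCT of a far-face `μ`-bond: `Π_{κ < μ}↑ h(z; κ, μ)^{q_κ L}`. [folklore] -/
def loProd (L : ℕ) (h : Site d → Fin d → Fin d → G) (z q : Site d) (μ : Fin d) : G :=
  prodOver (below μ) fun κ => (h z κ μ) ^ ((q κ).toNat * L)

/-- THE CLOSED-FORM BOND VALUE `[Π_{ν>μ}↑ (h^{q_ν})⁻¹]·([Π_{κ<μ}↑ h^{q_κ L}]·T(z,μ) if q_μ = L−1, else 1)`. [folklore] -/
def fullVal (L : ℕ) (T : Site d → Fin d → G) (h : Site d → Fin d → Fin d → G) (z q : Site d) (μ : Fin d) : G :=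
  hiProd h z q μ * (if q μ = (L : ℤ) - 1 then loProd L h z q μ * T z μ else 1)

/-- THE CLOSED-FORM FILLING OF ALL CELLS of the refined lattice `ℤ^d`. [folklore] -/
def fullFill (L : ℕ) (T : Site d → Fin d → G) (h : Site d → Fin d → Fin d → G) (x : Site d) (μ : Fin d) : G :=
  fullVal L T h (cdiv L x) (cmod L x) μ

/-- Unfolding `fullFill`. [folklore] -/
theorem fullFill_apply (L : ℕ) (T : Site d → Fin d → G) (h : Site d → Fin d → Fin d → G) (x : Site d) (μ : Fin d) :
    fullFill L T h x μ = fullVal L T h (cdiv L x) (cmod L x) μ := rfl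

/-- Row-product congruence: `hiProd` only reads the offsets in the directions above `μ`. [folklore] -/
theorem hiProd_congr (h : Site d → Fin d → Fin d → G) (z : Site d) {q q' : Site d} (μ : Fin d)
    (hq : ∀ ν, μ < ν → q' ν = q ν) : hiProd h z q' μ = hiProd h z q μ :=
  prodOver_congr fun ν hν => by rw [hq ν (mem_above.mp hν)]

/-- Compensating-product congruence: `loProd` only reads the offsets in the directions below `μ`. [folklore] -/
theorem loProd_congr (L : ℕ) (h : Site d → Fin d → Fin d → G) (z : Site d) {q q' : Site d} (μ : Fin d)
    (hq : ∀ κ, κ < μ → q' κ = q κ) : loProd L h z q' μ = loProd L h z q μ :=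
  prodOver_congr fun κ hκ => by rw [hq κ (mem_below.mp hκ)]

/-- A shift in a LOWER direction `κ < μ` is invisible to the row product of a `μ`-bond. [folklore] -/
theorem hiProd_add_of_lt (h : Site d → Fin d → Fin d → G) (z q : Site d) {κ μ : Fin d} (hκμ : κ < μ) (c : ℤ) :
    hiProd h z (q + c • e κ) μ = hiProd h z q μ :=
  hiProd_congr h z μ fun ν hν => by simp [e_apply, ne_of_gt (lt_trans hκμ hν)]

/-- A shift in a HIGHER direction `ν > μ` is invisible to the compensating product of a `μ`-bond. [folklore] -/
theorem loProd_add_of_gt (L : ℕ) (h : Site d → Fin d → Fin d → G) (z q : Site d) {μ ν : Fin d} (hμν : μ < ν) (c : ℤ) :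
    loProd L h z (q + c • e ν) μ = loProd L h z q μ :=
  loProd_congr L h z μ fun κ hκ => by simp [e_apply, ne_of_lt (lt_trans hκ hμν)]

end Products

/-! ## §2 On the 2-skeleton the closed form is row S4c's `cellVal`: `fullFill` is lawful -/

section Lawful

variable {G : Type*} [Group G] (L : ℕ) (T : Site d → Fin d → G) (h : Site d → Fin d → Fin d → G)

/-- With at most one non-zero transverse offset (direction `ν`), the row product is `(h(z;μ,ν)^{q_ν})⁻¹` if `μ < ν`, else `1`. [folklore] -/
theorem hiProd_of_support {z q : Site d} {μ ν : Fin d} (h0 : ∀ i, i ≠ μ → i ≠ ν → q i = 0) :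
    hiProd h z q μ = if μ < ν then ((h z μ ν) ^ (q ν).toNat)⁻¹ else 1 := by
  unfold hiProd
  rw [prodOver_eq_single (nodup_above μ) _ ν fun i hi hne => by
    rw [h0 i (ne_of_gt (mem_above.mp hi)) hne]; simp]
  simp only [mem_above]

/-- With at most one non-zero transverse offset (direction `ν`), the compensating product is `h(z;ν,μ)^{q_ν L}` if `ν < μ`, else `1`. [folklore] -/
theorem loProd_of_support {z q : Site d} {μ ν : Fin d} (h0 : ∀ i, i ≠ μ → i ≠ ν → q i = 0) :
    loProd L h z q μ = if ν < μ then (h z ν μ) ^ ((q ν).toNat * L) else 1 := by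
  unfold loProd
  rw [prodOver_eq_single (nodup_below μ) _ ν fun i hi hne => by
    rw [h0 i (ne_of_lt (mem_below.mp hi)) hne]; simp]
  simp only [mem_below]

/-- **ON THE 2-SKELETON THE CLOSED FORM IS `cellVal`.** [folklore] -/
theorem fullVal_eq_cellVal {z q : Site d} {μ ν : Fin d} (h0 : ∀ i, i ≠ μ → i ≠ ν → q i = 0) :
    fullVal L T h z q μ = cellVal L T h z q μ ν := by
  unfold fullVal cellVal
  rw [hiProd_of_support h h0, loProd_of_support L h h0]
  by_cases h1 : μ < ν
  · simp [h1, lt_asymm h1]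
  · by_cases h2 : ν < μ
    · simp [h1, h2]
    · simp [h1, h2]

/-- **`fullFill` IS LAWFUL ON THE 2-SKELETON** (row S4c's `LawfulFill`): it extends `skelFill`. [folklore] -/
theorem lawfulFill_fullFill : LawfulFill L T h (fullFill L T h) :=
  fun _ _ _ h0 => fullVal_eq_cellVal L T h h0

variable {L T h}

/-- Hence (row S4c BY NAME) every unit plaquette of every coarse 2-CELL of `fullFill` equals the root `h(z; κ, ν)`. [folklore] -/
theorem hol_plaq_fullFill_twoCell {κ ν : Fin d} (hκν : κ < ν) (z : Site d)
    (hroot : (h z κ ν) ^ (L * L) = hol T z (plaqWord κ ν)) {s t : ℕ} (hs : s < L) (ht : t < L) :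
    hol (fullFill L T h) ((L : ℤ) • z + off2 κ ν s t) (plaqWord κ ν) = h z κ ν :=
  hol_plaq_eq (lawfulFill_fullFill L T h) hκν z hroot hs ht

/-- Hence (row S4c BY NAME) every chain product of `fullFill` is the 1-skeleton datum `T(z, κ)`. [folklore] -/
theorem hol_seg_fullFill (hL : 1 ≤ L) (z : Site d) (κ : Fin d) :
    hol (fullFill L T h) ((L : ℤ) • z) (seg κ L) = T z κ :=
  hol_seg_eq (lawfulFill_fullFill L T h) hL z κ

end Lawful

/-! ## §3 Block coordinates of shifted sites and the bond values at the four bonds of a plaquette -/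

section Coordinates

variable {L : ℕ}

/-- In-range offsets: `q ∈ [0, L)^d`. [folklore] -/
def InBox (L : ℕ) (q : Site d) : Prop := ∀ i, 0 ≤ q i ∧ q i < L

/-- Stepping inside the block: if `q_μ < L − 1` then `q + e_μ ∈ [0, L)^d`. [folklore] -/
theorem inBox_add_e {q : Site d} (hq : InBox L q) {μ : Fin d} (hμ : q μ < (L : ℤ) - 1) : InBox L (q + e μ) := by
  intro i
  obtain ⟨h0, h1⟩ := hq i
  simp only [Pi.add_apply, e_apply]
  split_ifs with hi
  · subst hi; constructor <;> omega
  · simp [h0, h1]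

/-- Carrying across the far face: if `q_μ = L − 1` then `q + e_μ − L e_μ ∈ [0, L)^d` (`μ`-component `0`). [folklore] -/
theorem inBox_carry (hL : 1 ≤ L) {q : Site d} (hq : InBox L q) {μ : Fin d} (hμ : q μ = (L : ℤ) - 1) :
    InBox L (q + e μ - (L : ℤ) • e μ) := by
  intro i
  obtain ⟨h0, h1⟩ := hq i
  simp only [Pi.add_apply, Pi.sub_apply, Pi.smul_apply, e_apply, smul_eq_mul]
  split_ifs with hi
  · subst hi; constructor <;> omega
  · simp [h0, h1]

/-- Coordinates of `L z + q` for `q` in the box. [folklore] -/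
theorem cdiv_repr {z q : Site d} (hq : InBox L q) : cdiv L ((L : ℤ) • z + q) = z :=
  cdiv_eq_of_repr rfl (fun i => (hq i).1) (fun i => (hq i).2)

/-- Offsets of `L z + q` for `q` in the box. [folklore] -/
theorem cmod_repr {z q : Site d} (hq : InBox L q) : cmod L ((L : ℤ) • z + q) = q :=
  cmod_eq_of_repr rfl (fun i => (hq i).1) (fun i => (hq i).2)

/-- The carried site: `L z + q + e_μ = L (z + e_μ) + (q + e_μ − L e_μ)`. [folklore] -/
theorem carry_repr (z q : Site d) (μ : Fin d) :
    (L : ℤ) • z + q + e μ = (L : ℤ) • (z + e μ) + (q + e μ - (L : ℤ) • e μ) := by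
  rw [smul_add]; abel

variable {G : Type*} [Group G] {T : Site d → Fin d → G} {h : Site d → Fin d → Fin d → G}

/-- The bond value at a site written in block coordinates. [folklore] -/
theorem fullFill_repr {z q : Site d} (hq : InBox L q) (μ : Fin d) :
    fullFill L T h ((L : ℤ) • z + q) μ = fullVal L T h z q μ := by
  rw [fullFill_apply, cdiv_repr hq, cmod_repr hq]

/-- The bond value one step inside the block in direction `κ` (`q_κ < L − 1`). [folklore] -/
theorem fullFill_repr_step {z q : Site d} (hq : InBox L q) {κ : Fin d} (hκ : q κ < (L : ℤ) - 1) (μ : Fin d) :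
    fullFill L T h ((L : ℤ) • z + q + e κ) μ = fullVal L T h z (q + e κ) μ := by
  rw [add_assoc, fullFill_repr (inBox_add_e hq hκ)]

/-- The bond value one step across the far face in direction `κ` (`q_κ = L − 1`): block `z + e_κ`. [folklore] -/
theorem fullFill_repr_carry (hL : 1 ≤ L) {z q : Site d} (hq : InBox L q) {κ : Fin d} (hκ : q κ = (L : ℤ) - 1) (μ : Fin d) :
    fullFill L T h ((L : ℤ) • z + q + e κ) μ = fullVal L T h (z + e κ) (q + e κ - (L : ℤ) • e κ) μ := by
  rw [carry_repr, fullFill_repr (inBox_carry hL hq hκ)]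

end Coordinates

/-! ## §4 The four plaquette words -/

section Plaquettes

variable {G : Type*} [Group G] {L : ℕ} {T : Site d → Fin d → G} {h : Site d → Fin d → Fin d → G}

/-- The value of a `μ`-bond NOT on the far face (`q_μ ≠ L − 1`): the row product alone. [folklore] -/
theorem fullVal_of_ne {z q : Site d} {μ : Fin d} (hμ : q μ ≠ (L : ℤ) - 1) :
    fullVal L T h z q μ = hiProd h z q μ := by
  rw [fullVal, if_neg hμ, mul_one]

/-- The value of a `μ`-bond ON the far face (`q_μ = L − 1`): row · compensating product · chain datum. [folklore] -/
theorem fullVal_of_eq {z q : Site d} {μ : Fin d} (hμ : q μ = (L : ℤ) - 1) :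
    fullVal L T h z q μ = hiProd h z q μ * (loProd L h z q μ * T z μ) := by
  rw [fullVal, if_pos hμ]

/-- **PLAQUETTE WORD (I), INNER** (`q_μ, q_ν < L − 1`): `W(∂p) = Hμ(z,q)·Hν(z,q)·Hμ(z,q+e_ν)⁻¹·Hν(z,q)⁻¹` (abelian
reading: the single row factor `h(z;μ,ν)`; exact root when the row factors of different directions commute). [folklore] -/
theorem hol_plaq_fullFill_inner {z q : Site d} (hq : InBox L q) {μ ν : Fin d} (hμν : μ < ν)
    (hμ : q μ < (L : ℤ) - 1) (hν : q ν < (L : ℤ) - 1) :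
    hol (fullFill L T h) ((L : ℤ) • z + q) (plaqWord μ ν)
      = hiProd h z q μ * hiProd h z q ν * (hiProd h z (q + e ν) μ)⁻¹ * (hiProd h z q ν)⁻¹ := by
  have hν' : (q + e μ) ν ≠ (L : ℤ) - 1 := by
    simp only [Pi.add_apply, e_apply, if_neg (ne_of_gt hμν), add_zero]; exact ne_of_lt hν
  have hμ' : (q + e ν) μ ≠ (L : ℤ) - 1 := by
    simp only [Pi.add_apply, e_apply, if_neg (ne_of_lt hμν), add_zero]; exact ne_of_lt hμ
  rw [hol_plaqWord_eq, fullFill_repr hq, fullFill_repr_step hq hμ, fullFill_repr_step hq hν, fullFill_repr hq,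
    fullVal_of_ne (ne_of_lt hμ), fullVal_of_ne hν', fullVal_of_ne hμ', fullVal_of_ne (ne_of_lt hν),
    show q + e μ = q + (1 : ℤ) • e μ by rw [one_smul], hiProd_add_of_lt h z q hμν]

/-- **PLAQUETTE WORD (II), FAR IN `μ`** (`q_μ = L − 1 > q_ν`…): the `ν`-bond across the face lives in the block `z + e_μ`
and arrives CONJUGATED BY THE CHAIN DATUM: `W(∂p) = Hμ(z,q)·Lμ(z,q)T(z,μ)·Hν(z+e_μ,q)·T(z,μ)⁻¹Lμ(z,q)⁻¹·Hμ(z,q+e_ν)⁻¹·Hν(z,q)⁻¹`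
(the neighbour's row product does not read the `μ`-offset, so it is written at `q`). [folklore] -/
theorem hol_plaq_fullFill_farμ (hL : 1 ≤ L) {z q : Site d} (hq : InBox L q) {μ ν : Fin d} (hμν : μ < ν)
    (hμ : q μ = (L : ℤ) - 1) (hν : q ν < (L : ℤ) - 1) :
    hol (fullFill L T h) ((L : ℤ) • z + q) (plaqWord μ ν)
      = hiProd h z q μ * (loProd L h z q μ * T z μ) * hiProd h (z + e μ) q ν
        * ((loProd L h z q μ * T z μ)⁻¹ * (hiProd h z (q + e ν) μ)⁻¹) * (hiProd h z q ν)⁻¹ := by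
  have hν' : (q + e μ - (L : ℤ) • e μ) ν ≠ (L : ℤ) - 1 := by
    simp only [Pi.add_apply, Pi.sub_apply, Pi.smul_apply, e_apply, if_neg (ne_of_gt hμν), smul_eq_mul, mul_zero,
      add_zero, sub_zero]; exact ne_of_lt hν
  have hμ' : (q + e ν) μ = (L : ℤ) - 1 := by
    simp only [Pi.add_apply, e_apply, if_neg (ne_of_lt hμν), add_zero]; exact hμ
  have hHν : hiProd h (z + e μ) (q + e μ - (L : ℤ) • e μ) ν = hiProd h (z + e μ) q ν := by
    rw [show q + e μ - (L : ℤ) • e μ = q + (1 - (L : ℤ)) • e μ by rw [sub_smul, one_smul]; abel]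
    exact hiProd_add_of_lt h _ q hμν _
  rw [hol_plaqWord_eq, fullFill_repr hq, fullFill_repr_carry hL hq hμ, fullFill_repr_step hq hν, fullFill_repr hq,
    fullVal_of_eq hμ, fullVal_of_ne hν', fullVal_of_eq hμ', fullVal_of_ne (ne_of_lt hν), hHν,
    show q + e ν = q + (1 : ℤ) • e ν by rw [one_smul], loProd_add_of_gt L h z q hμν, mul_inv_rev]

/-- **PLAQUETTE WORD (III), FAR IN `ν`** (`q_ν = L − 1 > q_μ`…): the two `ν`-bonds' compensating products differ by one
step in `μ`; the `μ`-bond across the face lives in the block `z + e_ν`, conjugated by `T(z,ν)`: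
`W(∂p) = Hμ(z,q)·Hν(z,q)Lν(z,q+e_μ)T(z,ν)·Hμ(z+e_ν,q+e_ν−Le_ν)⁻¹·T(z,ν)⁻¹Lν(z,q)⁻¹Hν(z,q)⁻¹`. [folklore] -/
theorem hol_plaq_fullFill_farν (hL : 1 ≤ L) {z q : Site d} (hq : InBox L q) {μ ν : Fin d} (hμν : μ < ν)
    (hμ : q μ < (L : ℤ) - 1) (hν : q ν = (L : ℤ) - 1) :
    hol (fullFill L T h) ((L : ℤ) • z + q) (plaqWord μ ν)
      = hiProd h z q μ * (hiProd h z q ν * (loProd L h z (q + e μ) ν * T z ν))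
        * (hiProd h (z + e ν) (q + e ν - (L : ℤ) • e ν) μ)⁻¹
        * ((loProd L h z q ν * T z ν)⁻¹ * (hiProd h z q ν)⁻¹) := by
  have hν' : (q + e μ) ν = (L : ℤ) - 1 := by
    simp only [Pi.add_apply, e_apply, if_neg (ne_of_gt hμν), add_zero]; exact hν
  have hμ' : (q + e ν - (L : ℤ) • e ν) μ ≠ (L : ℤ) - 1 := by
    simp only [Pi.add_apply, Pi.sub_apply, Pi.smul_apply, e_apply, if_neg (ne_of_lt hμν), smul_eq_mul, mul_zero,
      add_zero, sub_zero]; exact ne_of_lt hμ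
  rw [hol_plaqWord_eq, fullFill_repr hq, fullFill_repr_step hq hμ, fullFill_repr_carry hL hq hν, fullFill_repr hq,
    fullVal_of_ne (ne_of_lt hμ), fullVal_of_eq hν', fullVal_of_ne hμ', fullVal_of_eq hν,
    show q + e μ = q + (1 : ℤ) • e μ by rw [one_smul], hiProd_add_of_lt h z q hμν, one_smul, mul_inv_rev]

/-- **PLAQUETTE WORD (IV), THE FAR CORNER** (`q_μ = q_ν = L − 1`): the chain-data plaquette `T(z,μ)T(z+e_μ,ν)T(z+e_ν,μ)⁻¹
T(z,ν)⁻¹` dressed by the row ∕ compensating products of the blocks `z`, `z + e_μ`, `z + e_ν`. [folklore] -/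
theorem hol_plaq_fullFill_corner (hL : 1 ≤ L) {z q : Site d} (hq : InBox L q) {μ ν : Fin d} (hμν : μ < ν)
    (hμ : q μ = (L : ℤ) - 1) (hν : q ν = (L : ℤ) - 1) :
    hol (fullFill L T h) ((L : ℤ) • z + q) (plaqWord μ ν)
      = hiProd h z q μ * (loProd L h z q μ * T z μ)
        * (hiProd h (z + e μ) q ν * (loProd L h (z + e μ) (q + e μ - (L : ℤ) • e μ) ν * T (z + e μ) ν))
        * (hiProd h (z + e ν) (q + e ν - (L : ℤ) • e ν) μ
            * (loProd L h (z + e ν) q μ * T (z + e ν) μ))⁻¹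
        * (hiProd h z q ν * (loProd L h z q ν * T z ν))⁻¹ := by
  have hν' : (q + e μ - (L : ℤ) • e μ) ν = (L : ℤ) - 1 := by
    simp only [Pi.add_apply, Pi.sub_apply, Pi.smul_apply, e_apply, if_neg (ne_of_gt hμν), smul_eq_mul, mul_zero,
      add_zero, sub_zero]; exact hν
  have hμ' : (q + e ν - (L : ℤ) • e ν) μ = (L : ℤ) - 1 := by
    simp only [Pi.add_apply, Pi.sub_apply, Pi.smul_apply, e_apply, if_neg (ne_of_lt hμν), smul_eq_mul, mul_zero,
      add_zero, sub_zero]; exact hμ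
  have hHν : hiProd h (z + e μ) (q + e μ - (L : ℤ) • e μ) ν = hiProd h (z + e μ) q ν := by
    rw [show q + e μ - (L : ℤ) • e μ = q + (1 - (L : ℤ)) • e μ by rw [sub_smul, one_smul]; abel]
    exact hiProd_add_of_lt h _ q hμν _
  have hLμ : loProd L h (z + e ν) (q + e ν - (L : ℤ) • e ν) μ = loProd L h (z + e ν) q μ := by
    rw [show q + e ν - (L : ℤ) • e ν = q + (1 - (L : ℤ)) • e ν by rw [sub_smul, one_smul]; abel]
    exact loProd_add_of_gt L h _ q hμν _
  rw [hol_plaqWord_eq, fullFill_repr hq, fullFill_repr_carry hL hq hμ, fullFill_repr_carry hL hq hν, fullFill_repr hq,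
    fullVal_of_eq hμ, fullVal_of_eq hν', fullVal_of_eq hμ', fullVal_of_eq hν, hHν, hLμ]

end Plaquettes

/-! ## §5 Transport: values in a subgroup; periodicity -/

section Transport

variable {G : Type*} [Group G] {L : ℕ} {T : Site d → Fin d → G} {h : Site d → Fin d → Fin d → G}

/-- `fullVal` takes values in any subgroup containing the data. [folklore] -/
theorem fullVal_mem {S : Subgroup G} (hT : ∀ z κ, T z κ ∈ S) (hh : ∀ z κ ν, h z κ ν ∈ S) (z q : Site d) (μ : Fin d) :
    fullVal L T h z q μ ∈ S := by
  unfold fullVal hiProd loProd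
  refine S.mul_mem (prodOver_mem fun ν _ => S.inv_mem (S.pow_mem (hh _ _ _) _)) ?_
  split_ifs
  · exact S.mul_mem (prodOver_mem fun κ _ => S.pow_mem (hh _ _ _) _) (hT _ _)
  · exact S.one_mem

/-- **The closed-form filling takes values in any subgroup containing the data** (e.g. the unitary group). [folklore] -/
theorem fullFill_mem {S : Subgroup G} (hT : ∀ z κ, T z κ ∈ S) (hh : ∀ z κ ν, h z κ ν ∈ S) (x : Site d) (μ : Fin d) :
    fullFill L T h x μ ∈ S :=
  fullVal_mem hT hh _ _ _

/-- **PERIODICITY**: `P`-periodic data `T`, `h` ⇒ the closed-form filling is `L·P`-periodic (refined torus). [folklore] -/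
theorem fullFill_add_period (hL : 1 ≤ L) {P : ℤ} (hT : ∀ z κ μ, T (z + P • e κ) μ = T z μ)
    (hh : ∀ z κ μ ν, h (z + P • e κ) μ ν = h z μ ν) (x : Site d) (κ μ : Fin d) :
    fullFill L T h (x + ((L : ℤ) * P) • e κ) μ = fullFill L T h x μ := by
  simp only [fullFill_apply, cdiv_add_period hL, cmod_add_period]
  unfold fullVal hiProd loProd
  simp only [hT, hh]

end Transport

end Summit.QuantumFields.BalabanUV.T4Continuum.SkeletonFillFull
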